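import Literature.Topology.FourManifolds.SpikedLoopLocal
import Literature.Topology.FourManifolds.Isotopy
import HarnessLib

/-!
# Conjugating a diffeomorphism of `𝕊³` into the chart `ψ`; near-identity maps on a ball

Topic `Literature/Topology/FourManifolds` (trunk T-4MAN). Fact seat
`provefact-Literature.Topology.FourManifolds.Knot.IsConnectedSum.isIsotopic` (Schubert's theorem),
geometric heart for rail knots; preliminaries of the **segment conjugation lemma** (the host of a
tiny inserted unit may be exchanged for an ambient isotopic host). Two independent pieces of
calculus:

* § chart conjugation: for an ambient isotopy `Ψ` of `𝕊³`, the end stage read in the stereographic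
  chart `ψ` from the north pole, `chartConj Ψ y = ψ (Ψ₁ (ψ⁻¹ y))`, and the same for `Ψ₁⁻¹`
  (`chartConjInv`); where `Ψ₁ (ψ⁻¹ y)` is not the north pole the first is `C^∞`
  (`contDiffAt_chartConj`), the two are inverse to each other near such points
  (`chartConjInv_chartConj`, eventual versions), hence the derivative `fderiv (chartConj Ψ) y` is
  invertible: the continuous linear equivalence `linConj Ψ hy` (chain rule on the eventual
  identities);
* § near-identity maps: if `P` is `C¹` near `o` with `P o = o` and `fderiv P o = id`, there is a
  closed ball `B̄(o, r_c)` on which every straight-line stage `P_t = id + t (P - id)`, `t ∈ [0, 1]`,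
  has `‖D P_t - id‖ ≤ 1/2`, is injective, satisfies `‖P_t y - o‖ ≤ (3/2) ‖y - o‖`, and has injective
  derivative (`exists_nearId_ball`, `lineStage_*`).

Everything is proved; no named facts are introduced.

## References

* M. W. Hirsch, *Differential Topology*, GTM 33, Springer (1976), Ch. 2 §1, Lemma 1.3; Ch. 8 §1.
  [HirschDT1976]
-/

open scoped Manifold ContDiff Topology Real
open Function Set Metric Filter

noncomputable section

namespace Literature.Topology.FourManifolds

/-- Local notation: `𝔼 n` is the model Euclidean space `EuclideanSpace ℝ (Fin n)`. -/
local notation "𝔼 " n:arg => EuclideanSpace ℝ (Fin n)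

/-- Local notation: `𝕊 n` is the unit sphere in `EuclideanSpace ℝ (Fin (n + 1))`. -/
local notation "𝕊 " n:arg => (Metric.sphere (0 : EuclideanSpace ℝ (Fin (n + 1))) 1)

attribute [local instance] fact_finrank_euclideanSpace_succ

open KnotsInBall

namespace SegmentConj

/-! ### Chart conjugation -/

variable (Ψ : AmbientIsotopy (𝓡 3) (𝕊 3))

/-- The end stage `Ψ₁` of the ambient isotopy, a diffeomorphism of `𝕊³`. [folklore] -/
abbrev stageOne : (𝕊 3) ≃ₘ⟮𝓡 3, 𝓡 3⟯ (𝕊 3) := Ψ.toDiffeomorph 1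

/-- **The end stage read in the chart**: `Φ y = ψ (Ψ₁ (ψ⁻¹ y))`. [folklore] -/
def chartConj (y : 𝔼 3) : 𝔼 3 := psiN (stageOne Ψ (psiN.symm y))

/-- The inverse end stage read in the chart: `ψ (Ψ₁⁻¹ (ψ⁻¹ y))`. [folklore] -/
def chartConjInv (y : 𝔼 3) : 𝔼 3 := psiN ((stageOne Ψ).symm (psiN.symm y))

/-- **Smoothness of the chart conjugate** at points `y` where `Ψ₁ (ψ⁻¹ y)` is not the north pole.
[folklore] -/
theorem contDiffAt_chartConj {y : 𝔼 3} (hy : stageOne Ψ (psiN.symm y) ≠ northPole) :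
    ContDiffAt ℝ ∞ (chartConj Ψ) y := by
  have h1 : ContMDiffAt 𝓘(ℝ, 𝔼 3) (𝓡 3) ∞ psiN.symm y := contMDiff_psiN_symm y
  have h2 : ContMDiffAt (𝓡 3) (𝓡 3) ∞ (stageOne Ψ) (psiN.symm y) := ((stageOne Ψ).contMDiff) _
  have h3 : ContMDiffAt (𝓡 3) 𝓘(ℝ, 𝔼 3) ∞ psiN (stageOne Ψ (psiN.symm y)) :=
    isFullChart_psiN.contMDiffAt (mem_psiN_source hy)
  exact contMDiffAt_iff_contDiffAt.1 (h3.comp y (h2.comp y h1))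

/-- Smoothness of the inverse chart conjugate. [folklore] -/
theorem contDiffAt_chartConjInv {y : 𝔼 3} (hy : (stageOne Ψ).symm (psiN.symm y) ≠ northPole) :
    ContDiffAt ℝ ∞ (chartConjInv Ψ) y := by
  have h1 : ContMDiffAt 𝓘(ℝ, 𝔼 3) (𝓡 3) ∞ psiN.symm y := contMDiff_psiN_symm y
  have h2 : ContMDiffAt (𝓡 3) (𝓡 3) ∞ (stageOne Ψ).symm (psiN.symm y) := ((stageOne Ψ).symm.contMDiff) _
  have h3 : ContMDiffAt (𝓡 3) 𝓘(ℝ, 𝔼 3) ∞ psiN ((stageOne Ψ).symm (psiN.symm y)) :=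
    isFullChart_psiN.contMDiffAt (mem_psiN_source hy)
  exact contMDiffAt_iff_contDiffAt.1 (h3.comp y (h2.comp y h1))

/-- The non-pole condition is open. [folklore] -/
theorem isOpen_setOf_stageOne_ne : IsOpen {y : 𝔼 3 | stageOne Ψ (psiN.symm y) ≠ northPole} :=
  isOpen_ne.preimage ((stageOne Ψ).continuous.comp contMDiff_psiN_symm.continuous)

/-- The non-pole condition for the inverse is open. [folklore] -/
theorem isOpen_setOf_stageOne_symm_ne : IsOpen {y : 𝔼 3 | (stageOne Ψ).symm (psiN.symm y) ≠ northPole} :=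
  isOpen_ne.preimage ((stageOne Ψ).symm.continuous.comp contMDiff_psiN_symm.continuous)

/-- `Φ⁻¹ (Φ y) = y` where `Ψ₁ (ψ⁻¹ y)` is not the north pole. [folklore] -/
theorem chartConjInv_chartConj {y : 𝔼 3} (hy : stageOne Ψ (psiN.symm y) ≠ northPole) :
    chartConjInv Ψ (chartConj Ψ y) = y := by
  rw [chartConjInv, chartConj, psiN_symm_apply_psiN hy, Diffeomorph.symm_apply_apply, psiN_apply_psiN_symm]

/-- `Φ (Φ⁻¹ y) = y` where `Ψ₁⁻¹ (ψ⁻¹ y)` is not the north pole. [folklore] -/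
theorem chartConj_chartConjInv {y : 𝔼 3} (hy : (stageOne Ψ).symm (psiN.symm y) ≠ northPole) :
    chartConj Ψ (chartConjInv Ψ y) = y := by
  rw [chartConj, chartConjInv, psiN_symm_apply_psiN hy, Diffeomorph.apply_symm_apply, psiN_apply_psiN_symm]

/-- At `Φ y`, for a good point `y`, the inverse condition holds. [folklore] -/
theorem stageOne_symm_chartConj_ne {y : 𝔼 3} (hy : stageOne Ψ (psiN.symm y) ≠ northPole) :
    (stageOne Ψ).symm (psiN.symm (chartConj Ψ y)) ≠ northPole := by
  rw [chartConj, psiN_symm_apply_psiN hy, Diffeomorph.symm_apply_apply]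
  exact psiN_symm_ne_northPole _

/-- `Φ⁻¹ ∘ Φ = id` near a good point. [folklore] -/
theorem chartConjInv_comp_eventuallyEq {y : 𝔼 3} (hy : stageOne Ψ (psiN.symm y) ≠ northPole) :
    chartConjInv Ψ ∘ chartConj Ψ =ᶠ[𝓝 y] id := by
  filter_upwards [(isOpen_setOf_stageOne_ne Ψ).mem_nhds hy] with y' hy'
  exact chartConjInv_chartConj Ψ hy'

/-- `Φ ∘ Φ⁻¹ = id` near `Φ y` for a good point `y`. [folklore] -/
theorem chartConj_comp_eventuallyEq {y : 𝔼 3} (hy : stageOne Ψ (psiN.symm y) ≠ northPole) :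
    chartConj Ψ ∘ chartConjInv Ψ =ᶠ[𝓝 (chartConj Ψ y)] id := by
  filter_upwards [(isOpen_setOf_stageOne_symm_ne Ψ).mem_nhds (stageOne_symm_chartConj_ne Ψ hy)] with y' hy'
  exact chartConj_chartConjInv Ψ hy'

/-- **The derivative of the chart conjugate is invertible** at a good point: the continuous linear
equivalence with `fderiv (chartConj Ψ) y` as its forward map (inverse `fderiv (chartConjInv Ψ) (Φ y)`,
chain rule on the two eventual identities). [folklore] -/
def linConj {y : 𝔼 3} (hy : stageOne Ψ (psiN.symm y) ≠ northPole) : (𝔼 3) ≃L[ℝ] 𝔼 3 := by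
  refine ContinuousLinearEquiv.equivOfInverse (fderiv ℝ (chartConj Ψ) y) (fderiv ℝ (chartConjInv Ψ) (chartConj Ψ y))
    (fun v ↦ ?_) (fun v ↦ ?_)
  · have hΦ := (contDiffAt_chartConj Ψ hy).differentiableAt (by simp)
    have hΦ' := (contDiffAt_chartConjInv Ψ (stageOne_symm_chartConj_ne Ψ hy)).differentiableAt (by simp)
    have hc := (hΦ'.hasFDerivAt.comp y hΦ.hasFDerivAt)
    have hid : HasFDerivAt (chartConjInv Ψ ∘ chartConj Ψ) (ContinuousLinearMap.id ℝ (𝔼 3)) y :=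
      (hasFDerivAt_id y).congr_of_eventuallyEq (chartConjInv_comp_eventuallyEq Ψ hy)
    have := hc.unique hid
    exact congrArg (fun f : (𝔼 3) →L[ℝ] 𝔼 3 ↦ f v) this
  · have hΦ' := (contDiffAt_chartConjInv Ψ (stageOne_symm_chartConj_ne Ψ hy)).differentiableAt (by simp)
    have hy' : chartConjInv Ψ (chartConj Ψ y) = y := chartConjInv_chartConj Ψ hy
    have hΦ : DifferentiableAt ℝ (chartConj Ψ) (chartConjInv Ψ (chartConj Ψ y)) := by
      rw [hy']; exact (contDiffAt_chartConj Ψ hy).differentiableAt (by simp)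
    have hc := (hΦ.hasFDerivAt.comp _ hΦ'.hasFDerivAt)
    have hid : HasFDerivAt (chartConj Ψ ∘ chartConjInv Ψ) (ContinuousLinearMap.id ℝ (𝔼 3)) (chartConj Ψ y) :=
      (hasFDerivAt_id _).congr_of_eventuallyEq (chartConj_comp_eventuallyEq Ψ hy)
    have := hc.unique hid
    rw [hy'] at this
    exact congrArg (fun f : (𝔼 3) →L[ℝ] 𝔼 3 ↦ f v) this

/-- The forward map of `linConj` is the derivative. [folklore] -/
@[simp] theorem coe_linConj {y : 𝔼 3} (hy : stageOne Ψ (psiN.symm y) ≠ northPole) :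
    ((linConj Ψ hy : (𝔼 3) ≃L[ℝ] 𝔼 3) : (𝔼 3) →L[ℝ] 𝔼 3) = fderiv ℝ (chartConj Ψ) y := rfl

/-- **Directional derivative along a segment carried affinely**: if `Φ (o + ρ d) = o' + ρ d'` for
`|ρ| ≤ ρ₀` (`ρ₀ > 0`) and `Φ` is differentiable at `o`, then `DΦ(o) d = d'`. [folklore] -/
theorem fderiv_apply_eq_of_segment {Φ : 𝔼 3 → 𝔼 3} {o o' d d' : 𝔼 3} {ρ₀ : ℝ} (hρ₀ : 0 < ρ₀)
    (hseg : ∀ ρ ∈ Icc (-ρ₀) ρ₀, Φ (o + ρ • d) = o' + ρ • d') (hΦ : DifferentiableAt ℝ Φ o) :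
    fderiv ℝ Φ o d = d' := by
  -- the curve `ρ ↦ Φ (o + ρ d)` has derivative `DΦ(o) d` and equals `o' + ρ d'` near `0`
  have hγ : HasDerivAt (fun ρ : ℝ ↦ o + ρ • d) d 0 := by
    simpa using ((hasDerivAt_id (0 : ℝ)).smul_const d).const_add o
  have h0 : o + (0 : ℝ) • d = o := by simp
  have hΦ0 : DifferentiableAt ℝ Φ (o + (0 : ℝ) • d) := by rw [h0]; exact hΦ
  have hcomp : HasDerivAt (fun ρ : ℝ ↦ Φ (o + ρ • d)) (fderiv ℝ Φ o d) 0 := by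
    have := hΦ0.hasFDerivAt.comp_hasDerivAt (0 : ℝ) hγ
    rw [h0] at this
    exact this
  have hline : HasDerivAt (fun ρ : ℝ ↦ o' + ρ • d') d' 0 := by
    simpa using ((hasDerivAt_id (0 : ℝ)).smul_const d').const_add o'
  have hev : (fun ρ : ℝ ↦ Φ (o + ρ • d)) =ᶠ[𝓝 0] fun ρ ↦ o' + ρ • d' := by
    filter_upwards [Ioo_mem_nhds (show -ρ₀ < 0 by linarith) hρ₀] with ρ hρ using hseg ρ (Ioo_subset_Icc_self hρ)
  exact (hcomp.congr_of_eventuallyEq hev.symm |>.unique hline)  -- careful with direction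

/-! ### Near-identity maps on a ball -/

section NearId

variable {P : 𝔼 3 → 𝔼 3} {o : 𝔼 3}

/-- **The straight-line stage** `P_t y = y + t (P y - y)`. [folklore] -/
def lineStage (P : 𝔼 3 → 𝔼 3) (t : ℝ) (y : 𝔼 3) : 𝔼 3 := y + t • (P y - y)

/-- At `t = 0` the straight-line stage is the identity. [folklore] -/
@[simp] theorem lineStage_zero (P : 𝔼 3 → 𝔼 3) (y : 𝔼 3) : lineStage P 0 y = y := by simp [lineStage]

/-- At `t = 1` the straight-line stage is `P`. [folklore] -/
@[simp] theorem lineStage_one (P : 𝔼 3 → 𝔼 3) (y : 𝔼 3) : lineStage P 1 y = P y := by simp [lineStage]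

/-- Fixed points of `P` are fixed by every stage. [folklore] -/
theorem lineStage_of_eq {t : ℝ} {y : 𝔼 3} (h : P y = y) : lineStage P t y = y := by simp [lineStage, h]

/-- The straight-line stages are jointly `C^∞` if `P` is. [folklore] -/
theorem contDiff_lineStage_uncurry (hP : ContDiff ℝ ∞ P) : ContDiff ℝ ∞ (fun p : ℝ × 𝔼 3 ↦ lineStage P p.1 p.2) :=
  contDiff_snd.add (contDiff_fst.smul ((hP.comp contDiff_snd).sub contDiff_snd))

/-- The derivative of the straight-line stage: `id + t (DP - id)`. [folklore] -/
theorem hasFDerivAt_lineStage {t : ℝ} {y : 𝔼 3} {D : (𝔼 3) →L[ℝ] 𝔼 3} (hP : HasFDerivAt P D y) :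
    HasFDerivAt (lineStage P t) (ContinuousLinearMap.id ℝ (𝔼 3) + t • (D - ContinuousLinearMap.id ℝ (𝔼 3))) y :=
  (hasFDerivAt_id y).add ((hP.sub (hasFDerivAt_id y)).const_smul t)

/-- **The near-identity ball**: if `P` is `C^∞` on an open set `U ∋ o` with `P o = o` and
`fderiv P o = id`, there is `r_c > 0` with `B̄(o, r_c) ⊆ U` and `‖fderiv P y - id‖ ≤ 1/2` on
`B̄(o, r_c)`. [folklore] -/
theorem exists_nearId_ball {U : Set (𝔼 3)} (hU : IsOpen U) (ho : o ∈ U) (hP : ContDiffOn ℝ ∞ P U)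
    (hD : fderiv ℝ P o = ContinuousLinearMap.id ℝ (𝔼 3)) :
    ∃ rc > 0, closedBall o rc ⊆ U ∧ ∀ y ∈ closedBall o rc, ‖fderiv ℝ P y - ContinuousLinearMap.id ℝ (𝔼 3)‖ ≤ 1 / 2 := by
  have hPa : ContDiffAt ℝ ∞ P o := hP.contDiffAt (hU.mem_nhds ho)
  have hcont : ContinuousAt (fderiv ℝ P) o := hPa.continuousAt_fderiv (by simp)
  have hev : ∀ᶠ y in 𝓝 o, ‖fderiv ℝ P y - ContinuousLinearMap.id ℝ (𝔼 3)‖ ≤ 1 / 2 := by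
    have h1 : ∀ᶠ y in 𝓝 o, dist (fderiv ℝ P y) (fderiv ℝ P o) < 1 / 2 :=
      hcont (ball_mem_nhds _ (by norm_num))
    filter_upwards [h1] with y hy
    rw [dist_eq_norm, hD] at hy
    exact hy.le
  obtain ⟨r₁, hr₁, hball⟩ := Metric.eventually_nhds_iff_ball.1 (hev.and (hU.mem_nhds ho |> Filter.eventually_of_mem <| fun y hy ↦ hy))
  refine ⟨r₁ / 2, by positivity, fun y hy ↦ (hball y (closedBall_subset_ball (by linarith) hy)).2,
    fun y hy ↦ (hball y (closedBall_subset_ball (by linarith) hy)).1⟩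

variable {rc : ℝ} {U : Set (𝔼 3)} (hU : IsOpen U) (hsub : closedBall o rc ⊆ U) (hP : ContDiffOn ℝ ∞ P U)
  (hbd : ∀ y ∈ closedBall o rc, ‖fderiv ℝ P y - ContinuousLinearMap.id ℝ (𝔼 3)‖ ≤ 1 / 2)
include hU hsub hP hbd

/-- On the near-identity ball, `P - id` (scaled by `t ∈ [0, 1]`) is `1/2`-Lipschitz. [folklore] -/
theorem norm_sub_sub_le {t : ℝ} (ht : t ∈ Icc (0 : ℝ) 1) {y y' : 𝔼 3} (hy : y ∈ closedBall o rc) (hy' : y' ∈ closedBall o rc) :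
    ‖(lineStage P t y - y) - (lineStage P t y' - y')‖ ≤ 1 / 2 * ‖y - y'‖ := by
  -- mean value inequality for `g = t (P - id)` on the convex ball
  have hdiff : ∀ z ∈ closedBall o rc, HasFDerivWithinAt (fun z ↦ t • (P z - z))
      (t • (fderiv ℝ P z - ContinuousLinearMap.id ℝ (𝔼 3))) (closedBall o rc) z := fun z hz ↦ by
    have hPz : HasFDerivAt P (fderiv ℝ P z) z :=
      ((hP.contDiffAt (hU.mem_nhds (hsub hz))).differentiableAt (by simp)).hasFDerivAt
    exact ((hPz.sub (hasFDerivAt_id z)).const_smul t).hasFDerivWithinAt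
  have hbound : ∀ z ∈ closedBall o rc, ‖t • (fderiv ℝ P z - ContinuousLinearMap.id ℝ (𝔼 3))‖ ≤ 1 / 2 := fun z hz ↦ by
    rw [norm_smul, Real.norm_eq_abs, abs_of_nonneg ht.1]
    calc t * ‖fderiv ℝ P z - ContinuousLinearMap.id ℝ (𝔼 3)‖ ≤ 1 * (1 / 2) := by
          gcongr; exacts [ht.2, hbd z hz]
      _ = 1 / 2 := by ring
  have key := (convex_closedBall o rc).norm_image_sub_le_of_norm_hasFDerivWithin_le hdiff hbound hy' hy
  simpa [lineStage] using key

/-- **The straight-line stages are injective on the near-identity ball.** [folklore] -/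
theorem injOn_lineStage {t : ℝ} (ht : t ∈ Icc (0 : ℝ) 1) : InjOn (lineStage P t) (closedBall o rc) := by
  intro y hy y' hy' he
  have h := norm_sub_sub_le hU hsub hP hbd ht hy hy'
  rw [he] at h
  have e : lineStage P t y' - y - (lineStage P t y' - y') = y' - y := by abel
  rw [e, norm_sub_rev] at h
  have : ‖y - y'‖ = 0 := by nlinarith [norm_nonneg (y - y')]
  exact sub_eq_zero.1 (norm_eq_zero.1 this)

/-- **The straight-line stages move points by at most half their distance to the centre** (if
`P o = o`): `‖P_t y - o‖ ≤ (3/2) ‖y - o‖`. [folklore] -/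
theorem norm_lineStage_sub_le (hrc : 0 ≤ rc) (hPo : P o = o) {t : ℝ} (ht : t ∈ Icc (0 : ℝ) 1) {y : 𝔼 3} (hy : y ∈ closedBall o rc) :
    ‖lineStage P t y - o‖ ≤ 3 / 2 * ‖y - o‖ := by
  have ho : o ∈ closedBall o rc := mem_closedBall_self hrc
  have h := norm_sub_sub_le hU hsub hP hbd ht hy ho
  rw [lineStage_of_eq hPo, sub_self, sub_zero] at h
  calc ‖lineStage P t y - o‖ = ‖(lineStage P t y - y) + (y - o)‖ := by congr 1; abel
    _ ≤ ‖lineStage P t y - y‖ + ‖y - o‖ := norm_add_le _ _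
    _ ≤ _ := by linarith

/-- **The derivative of a straight-line stage is injective on the near-identity ball.** [folklore] -/
theorem injective_fderiv_lineStage {t : ℝ} (ht : t ∈ Icc (0 : ℝ) 1) {y : 𝔼 3} (hy : y ∈ closedBall o rc) :
    Injective (fderiv ℝ (lineStage P t) y) := by
  have hPz : HasFDerivAt P (fderiv ℝ P y) y :=
    ((hP.contDiffAt (hU.mem_nhds (hsub hy))).differentiableAt (by simp)).hasFDerivAt
  rw [(hasFDerivAt_lineStage (t := t) hPz).fderiv]
  intro v w hvw
  set M := t • (fderiv ℝ P y - ContinuousLinearMap.id ℝ (𝔼 3))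
  have hM : ‖M‖ ≤ 1 / 2 := by
    rw [norm_smul, Real.norm_eq_abs, abs_of_nonneg ht.1]
    calc t * ‖fderiv ℝ P y - ContinuousLinearMap.id ℝ (𝔼 3)‖ ≤ 1 * (1 / 2) := by
          gcongr; exacts [ht.2, hbd y hy]
      _ = 1 / 2 := by ring
  have h1 : (v - w) + M (v - w) = 0 := by
    have : v + M v = w + M w := hvw
    rw [map_sub]
    calc v - w + (M v - M w) = (v + M v) - (w + M w) := by abel
      _ = 0 := by rw [this, sub_self]
  have h2 : ‖M (v - w)‖ ≤ 1 / 2 * ‖v - w‖ := (M.le_opNorm _).trans (mul_le_mul_of_nonneg_right hM (norm_nonneg _))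
  have h3 : ‖v - w‖ = ‖M (v - w)‖ := by
    have : v - w = -(M (v - w)) := eq_neg_of_add_eq_zero_left h1
    conv_lhs => rw [this]
    rw [norm_neg]
  have : ‖v - w‖ = 0 := by nlinarith [norm_nonneg (v - w)]
  exact sub_eq_zero.1 (norm_eq_zero.1 this)

end NearId

end SegmentConj

end Literature.Topology.FourManifolds
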